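import Summits.HodgeConjecture.CorCM.CMAbelianFivefoldPowers
import Summits.HodgeConjecture.CorCM.SimpleCMProductsDimLeThreeHodge
import HarnessLib

/-!
# Three INTRINSIC obstructions to `B• = D•` on the powers of a complex abelian variety of CM type, in every dimension:
# two simple factors sharing an imaginary quadratic field, four simple threefolds with one endomorphism field, three
# simple surfaces with one Galois closure

COR-CM (cell `pub-hodgecm2`, binder seat `b16` gen 44, count-neutral claim CM-DIMLE3-INTRINSIC, file F1; theorems only, no
definition, no named fact, no `sorry`).  NEW as stated (an assembly of tree theorems), hence under `Summits/`.  HONEST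
FRAMING: unconditional structure theorems on CM abelian varieties; not a step of the summit chain (`HC_CM` is neither used
nor advanced).

Seat b16's census of products of SIMPLE CM abelian varieties of dimension `≤ 3` (`CorCM/SimpleCMProductsDimLeThreeHodge`,
`isNondegenerateFamily_simpleFamily_dim_le_three_iff`: nondegenerate iff (i) no imaginary quadratic field embeds in two of
the CM fields, (ii) no sextic CM field occurs more than three times, (iii) no Galois closure carries more than two of the
quartic fields) is stated there on REALISATION DATA `(K_i; Φ_i; A_i, ι_i, θ_i)`.  This file and its sequel
(`CorCM/CMAbelianFactorsDimLeThreeClassification`) restate it ON ONE VARIETY, INTRINSICALLY — for a complex abelian variety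
`X` of CM type (`Milne1999.IsOfCMType`, the binder of `HC_CM`) through its simple ISOGENY FACTORS
(`Domination.AVDominatedBy B X`, Mumford §19) and their ENDOMORPHISM ALGEBRAS `End⁰(B) = B.endAlgebra` — exactly as seat
b16 gen 38 did for `dim X ≤ 5` (`CorCM/CMAbelianFivefoldPowers`) and seat b27 at Mumford–Tate rank `≤ 4`
(`CorCM/MumfordTateRankFourCMIntrinsic`).  Here: the three obstructions, each valid in EVERY dimension and with NO
hypothesis on the other factors of `X`.

* §1 `iSup_adjoin_range_eq_normalClosure` — the INTRINSIC GALOIS CLOSURE of an endomorphism field: for a ring `R ≃ K`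
  (`K` a number field) the subfield of `ℂ` generated by the images of all ring maps `R → ℂ`,
  `⨆_{f : R →+* ℂ} ℚ(range f)`, is the Galois closure `normalClosure ℚ K ℂ`; `isNondegenerateFamily_comp_of_injective` —
  re-indexing a nondegenerate family along an injection keeps it nondegenerate (Hazama, 7.6.1).
* §2 **`exists_not_isDivisorGenerated_powSucc_of_shared_imaginary_quadratic`** — (¬i′) two NON-ISOGENOUS simple isogeny
  factors `B`, `B′` of `X` of positive dimension and an imaginary quadratic number field `k` with ring maps
  `k → End⁰(B)`, `k → End⁰(B′)` ⟹ some power `X^{N+1}` is NOT divisor-generated.  This removes the elliptic curve from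
  seat b27's `exists_not_isDivisorGenerated_powSucc_of_curve_factor_of_ringHom` (there `B = E` is a curve and `k = End⁰(E)`):
  two simple CM THREEFOLDS whose sextic fields share an imaginary quadratic subfield already obstruct (Moonen–Zarhin list
  only the curve cases (a), (e)–(g), all in dimension `≤ 5`).
* §3 **`exists_not_isDivisorGenerated_powSucc_of_four_threefold_factors`** — (¬ii′) four pairwise non-isogenous simple
  abelian THREEFOLDS among the isogeny factors of `X` with pairwise isomorphic endomorphism algebras ⟹ some power of `X` is
  not divisor-generated (seat p2's «four isogeny classes of one sextic field», transported);
  **`exists_not_isDivisorGenerated_powSucc_of_three_surface_factors`** — (¬iii′) three pairwise non-isogenous simple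
  abelian SURFACES among the isogeny factors of `X` whose endomorphism fields generate the same subfield of `ℂ` by all their
  complex embeddings (= have the same Galois closure) ⟹ some power of `X` is not divisor-generated (seat p2's dihedral
  triple, transported).

MECHANISM (uniform).  Milne's regrouping `X ∼ ⨁ᵢ A'_{cls i}` into simple, pairwise non-isogenous CM representatives (seat b16
gen 36, `exists_isIsogeny_biproduct_of_isSimple_of_isOfCMType`); a simple factor of `X` of positive dimension is isogenous to
a representative (uniqueness of simple factors, gen 38), whose CM field is `≅ End⁰` (Shimura §5.1); so the given factors
single out an injective set of slots on which the type-level obstruction applies (b23's shared-quadratic lemma; the census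
(ii)/(iii) on the re-indexed sub-family, §1); a degenerate separating family carries an exceptional class on some product of
representatives (Hazama–Murty), which is an isogeny factor of a power of `X` (seat b27's
`exists_avDominatedBy_biproduct_slots_powSucc`), and `B = D` descends along dominations.

## References

* [MoonenZarhin1999LowDim] B. Moonen, Yu. Zarhin, *Hodge classes on abelian varieties of low dimension*, Math. Ann. 315
  (1999) 711–733, Thm. (0.2) (a), (e)–(g), (1)–(3); §3 (3.1), (3.9).
* [Gordon1999HodgeAVSurvey] B. B. Gordon, *A survey of the Hodge conjecture for abelian varieties*, §3 Theorem, 7.5–7.7,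
  9.4.
* [MumfordAV1970] D. Mumford, *Abelian Varieties*, §19 Thm. 1, Cor. 1–2 (pp. 173–174).
* [Shimura1998] G. Shimura, *Abelian Varieties with Complex Multiplication and Modular Functions*, §5.1 Props. 3–6, §8.4.
-/

noncomputable section

open CategoryTheory CategoryTheory.Limits NumberField Module IntermediateField
open scoped BigOperators

namespace Summit.HodgeConjecture.CorCM

open Literature.NumberTheory.ComplexMultiplication
open Literature.AlgebraicGeometry.Motives (AbelianVariety CMType)
open Literature.AlgebraicGeometry.Motives.AbelianVariety
open Literature.AlgebraicGeometry.HodgeTheory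
open Literature.AlgebraicGeometry.ComplexMultiplication (IsCMTypeRealisation)
open Literature.AlgebraicGeometry.Milne1999
open Literature.AlgebraicGeometry.Pohlmann1968
open Summit.HodgeConjecture.CorCM.Domination
open Summit.HodgeConjecture.HodgeConjecture.Ring2.Atlas (nonempty_ringEquiv_endAlgebra_of_isSimple)

/-! ## §1 Plumbing: the intrinsic Galois closure of an endomorphism field; sub-families along injections -/

section Plumbing

/-- **The intrinsic Galois closure.**  For a ring `R` isomorphic to a number field `K`, the subfield of `ℂ` generated over
`ℚ` by the images of ALL ring maps `R → ℂ` is the Galois closure of `K` in `ℂ`: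
`⨆_{f : R →+* ℂ} ℚ(range f) = normalClosure ℚ K ℂ` (ring maps out of `R` are the `ℚ`-algebra maps out of `K`
composed with the isomorphism).  Applied to `R = End⁰(B)` of a simple CM abelian variety `B` (`End⁰(B) ≅ K`, Shimura §5.1)
this is the Galois closure of the endomorphism field, with no field structure on `End⁰(B)` needed. [cite: Shimura1998, §5.1 Props. 3–6 and §8.4] -/
theorem iSup_adjoin_range_eq_normalClosure {K : Type} [Field K] [NumberField K] {R : Type} [Ring R] [Algebra ℚ R]
    (e : K ≃+* R) :
    (⨆ f : R →+* ℂ, IntermediateField.adjoin ℚ (Set.range f)) = normalClosure ℚ K ℂ := by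
  apply le_antisymm
  · refine iSup_le fun f => ?_
    refine le_trans ?_ (AlgHom.fieldRange_le_normalClosure (f.comp e.toRingHom).toRatAlgHom)
    rw [IntermediateField.adjoin_le_iff]
    rintro x ⟨y, rfl⟩
    refine ⟨e.symm y, ?_⟩
    change f (e (e.symm y)) = f y
    rw [e.apply_symm_apply]
  · rw [normalClosure_le_iff]
    intro g
    refine le_trans ?_ (le_iSup (fun f : R →+* ℂ => IntermediateField.adjoin ℚ (Set.range f))
      (g.toRingHom.comp e.symm.toRingHom))
    rintro x ⟨y, rfl⟩
    refine IntermediateField.subset_adjoin ℚ _ ⟨e y, ?_⟩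
    change g (e.symm (e y)) = g y
    rw [e.symm_apply_apply]

/-- **Two rings isomorphic to number fields with the same intrinsic Galois closure have Galois closures which coincide**
(both sides of `iSup_adjoin_range_eq_normalClosure`). [cite: Shimura1998, §8.4] -/
theorem normalClosure_eq_of_iSup_adjoin_range_eq {K K' : Type} [Field K] [NumberField K] [Field K'] [NumberField K']
    {R R' : Type} [Ring R] [Algebra ℚ R] [Ring R'] [Algebra ℚ R'] (e : K ≃+* R) (e' : K' ≃+* R')
    (h : (⨆ f : R →+* ℂ, IntermediateField.adjoin ℚ (Set.range f)) =
      ⨆ f : R' →+* ℂ, IntermediateField.adjoin ℚ (Set.range f)) :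
    normalClosure ℚ K ℂ = normalClosure ℚ K' ℂ := by
  rw [← iSup_adjoin_range_eq_normalClosure e, ← iSup_adjoin_range_eq_normalClosure e', h]

/-- **Isomorphic rings have the same intrinsic Galois closure** (re-index the ring maps to `ℂ` along the isomorphism).
[folklore] -/
theorem iSup_adjoin_range_eq_of_ringEquiv {R R' : Type} [Ring R] [Ring R'] (u : R ≃+* R') :
    (⨆ f : R →+* ℂ, IntermediateField.adjoin ℚ (Set.range f)) =
      ⨆ f : R' →+* ℂ, IntermediateField.adjoin ℚ (Set.range f) := by
  apply le_antisymm
  · refine iSup_le fun f => le_trans (le_of_eq ?_)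
      (le_iSup (fun f : R' →+* ℂ => IntermediateField.adjoin ℚ (Set.range f)) (f.comp u.symm.toRingHom))
    congr 1
    ext x
    constructor
    · rintro ⟨y, rfl⟩
      exact ⟨u y, by change f (u.symm (u y)) = f y; rw [u.symm_apply_apply]⟩
    · rintro ⟨y, rfl⟩
      exact ⟨u.symm y, rfl⟩
  · refine iSup_le fun f => le_trans (le_of_eq ?_)
      (le_iSup (fun f : R →+* ℂ => IntermediateField.adjoin ℚ (Set.range f)) (f.comp u.toRingHom))
    congr 1
    ext x
    constructor
    · rintro ⟨y, rfl⟩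
      exact ⟨u.symm y, by change f (u (u.symm y)) = f y; rw [u.apply_symm_apply]⟩
    · rintro ⟨y, rfl⟩
      exact ⟨u y, rfl⟩

variable {I : Type} {K : I → Type} [∀ i, Field (K i)] [∀ i, NumberField (K i)] [∀ i, IsCMField (K i)] [Fintype I]
  {Φ : ∀ i, CMType (K i)}

/-- **Re-indexing a nondegenerate family along an INJECTION keeps it nondegenerate** (the sub-family on the image,
`isNondegenerateFamily_subtype`, re-indexed by `Equiv.ofInjective`; Hazama: abelian subvarieties of stably nondegenerate
abelian varieties are stably nondegenerate). [cite: Gordon1999HodgeAVSurvey, 7.6.1] -/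
theorem isNondegenerateFamily_comp_of_injective (hΦ : CMAlgebra.IsNondegenerateFamily Φ) {J : Type} [Fintype J]
    [Nonempty J] (c : J → I) (hc : Function.Injective c) :
    CMAlgebra.IsNondegenerateFamily (K := fun j => K (c j)) fun j => Φ (c j) := by
  classical
  obtain ⟨j₀⟩ := ‹Nonempty J›
  have hsub := isNondegenerateFamily_subtype hΦ (fun i => i ∈ Set.range c) ⟨c j₀, j₀, rfl⟩
  exact (isNondegenerateFamily_iff_of_equiv (K := fun i : {i // i ∈ Set.range c} => K i.1) (fun i => Φ i.1)
    (Equiv.ofInjective c hc)).2 (by convert hsub)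

end Plumbing

variable {X : AbelianVariety ℂ}

/-! ## §2 Obstruction (¬i′): two non-isogenous simple factors sharing an imaginary quadratic field -/

section SharedQuadratic

/-- A dominated abelian variety of positive dimension forces the dominating one to have positive dimension (`[N]_B ≠ 0`
factors through `X`). [cite: MumfordAV1970, §19 Thm. 3 and Remark p. 169] -/
theorem dim_pos_of_avDominatedBy {B : AbelianVariety ℂ} (hB0 : 0 < B.dim) (hBX : AVDominatedBy B X) : 0 < X.dim := by
  obtain ⟨s, π, N, hN, hsπ⟩ := hBX
  by_contra h0
  push Not at h0
  have hπ0 : π = 0 := hom_eq_zero_of_dim_eq_zero (Or.inl (by omega)) π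
  exact (ne_zero_of_comp_eq_nsmul_id hN hsπ hB0).2 hπ0

/-- **(¬i′) ⟹ an exotic Hodge class on some power — EVERY dimension.**  Let `X` be a complex abelian variety of CM type,
`B`, `B′` two NON-ISOGENOUS SIMPLE isogeny factors of `X` of positive dimension, and `k` an imaginary quadratic number
field with ring maps `k → End⁰(B)` and `k → End⁰(B′)`.  Then some power `X^{N+1}` is NOT divisor-generated.  (Regroup
`X ∼ ⨁ᵢ A'_{cls i}`; `B ∼ A'_a`, `B′ ∼ A'_b` with `a ≠ b`; `k ↪ End⁰(B) ≅ End⁰(A'_a) ≅ K'_a` and likewise for `b`: two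
representatives share an imaginary quadratic field, so the family of representatives is degenerate whatever the types —
seat b23's `not_isNondegenerateFamily_of_shared_imaginary_quadratic`; Hazama–Murty put an exceptional class on a product of
representatives, an isogeny factor of a power of `X`.)  For `B = E` an elliptic curve and `k = End⁰(E)` this is seat b27's
curve obstruction / Moonen–Zarhin (0.2) (a), (e)–(g); two simple CM threefolds `T`, `T′` whose sextic fields contain one
imaginary quadratic field are the first curve-free instance (`dim X ≥ 6`).
[cite: MoonenZarhin1999LowDim, Thm. (0.2) (a), (e)–(g), (1)–(3)] [cite: Gordon1999HodgeAVSurvey, §3 Theorem, 7.5 and 9.4] -/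
theorem exists_not_isDivisorGenerated_powSucc_of_shared_imaginary_quadratic (hcm : IsOfCMType X)
    {B B' : AbelianVariety ℂ} (hB : B.IsSimple) (hB' : B'.IsSimple) (hB0 : 0 < B.dim) (hB'0 : 0 < B'.dim)
    (hBX : AVDominatedBy B X) (hB'X : AVDominatedBy B' X) (hBB' : ¬ IsIsogenous B B')
    {k : Type} [Field k] [NumberField k] [IsTotallyComplex k] (hk : finrank ℚ k = 2)
    (j : k →+* B.endAlgebra) (j' : k →+* B'.endAlgebra) :
    ∃ N : ℕ, ¬ IsDivisorGenerated (X.powSucc N) := by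
  classical
  have hX0 : 0 < X.dim := dim_pos_of_avDominatedBy hB0 hBX
  obtain ⟨C, _, K', _, _, _, Φ', A', ι', θ', m, cls, f, hA, hs, hniso, hcls, hf⟩ :=
    exists_isIsogeny_biproduct_of_isSimple_of_isOfCMType (X := X) hX0 hcm
  haveI : Nonempty C := ⟨cls 0⟩
  have hXP : AVDominatedBy X (⨁ fun i => A' (cls i)) := AVDominatedBy.of_isIsogeny_hom hf (AVDominatedBy.refl _)
  -- `B ∼ A'_{cls i}`, `B' ∼ A'_{cls i'}`
  obtain ⟨i, hi⟩ := exists_isIsogenous_of_isSimple_of_avDominatedBy_biproduct (F := fun i => A' (cls i))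
    (fun i => hs (cls i)) hB hB0 (hBX.trans hXP)
  obtain ⟨i', hi'⟩ := exists_isIsogenous_of_isSimple_of_avDominatedBy_biproduct (F := fun i => A' (cls i))
    (fun i => hs (cls i)) hB' hB'0 (hB'X.trans hXP)
  have hii' : cls i ≠ cls i' := by
    intro h
    apply hBB'
    have hi'' : IsIsogenous B' (A' (cls i)) := by rw [h]; exact hi'
    exact hi.trans hi''.symm'
  -- `k ↪ End⁰(B) ≅ End⁰(A'_{cls i}) ≅ K'_{cls i}`, and likewise for `i'`
  obtain ⟨eB⟩ := nonempty_ringEquiv_endAlgebra_of_isSimple (hA (cls i)) (hs (cls i))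
  obtain ⟨eB'⟩ := nonempty_ringEquiv_endAlgebra_of_isSimple (hA (cls i')) (hs (cls i'))
  obtain ⟨uB⟩ := hi.nonempty_endAlgebra_algEquiv
  obtain ⟨uB'⟩ := hi'.nonempty_endAlgebra_algEquiv
  let j₀ : k →+* K' (cls i) := eB.symm.toRingHom.comp (uB.toRingEquiv.toRingHom.comp j)
  let j₁ : k →+* K' (cls i') := eB'.symm.toRingHom.comp (uB'.toRingEquiv.toRingHom.comp j')
  -- the family of representatives is degenerate, whatever the types
  have hdeg : ¬ CMAlgebra.IsNondegenerateFamily Φ' :=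
    not_isNondegenerateFamily_of_shared_imaginary_quadratic (k := k) hk hii' j₀ j₁ Φ'
  obtain ⟨N, π, mm, c, hcQ, hcH, hcD⟩ := CMAlgebra.exists_exceptional_prod_of_not_isNondegenerateFamily
    (CMAlgebra.isSeparatingFamily_of_isSimple_of_pairwise_not_isIsogenous hA hs hniso) hdeg hA
  obtain ⟨M, hM⟩ := exists_avDominatedBy_biproduct_slots_powSucc hcls ⟨f, hf⟩ π
  exact ⟨M, fun hD => hcD (isDivisorGenerated_of_avDominatedBy hM hD mm c hcQ hcH)⟩

/-- **(¬i′), subfield form**: the same with the shared imaginary quadratic field given as a totally complex quadratic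
intermediate field `F ≤ K` of a number field `K ≅ End⁰(B)` together with a ring map `F → End⁰(B′)` (the shape of condition
(i) of the realisation-level census). [cite: MoonenZarhin1999LowDim, Thm. (0.2) (a) and (1)–(3)] -/
theorem exists_not_isDivisorGenerated_powSucc_of_quadratic_subfield (hcm : IsOfCMType X)
    {B B' : AbelianVariety ℂ} (hB : B.IsSimple) (hB' : B'.IsSimple) (hB0 : 0 < B.dim) (hB'0 : 0 < B'.dim)
    (hBX : AVDominatedBy B X) (hB'X : AVDominatedBy B' X) (hBB' : ¬ IsIsogenous B B')
    {K : Type} [Field K] [NumberField K] (e : K ≃+* B.endAlgebra) {F : IntermediateField ℚ K}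
    (hF2 : finrank ℚ F = 2) (hFc : IsTotallyComplex F) (g : F →+* B'.endAlgebra) :
    ∃ N : ℕ, ¬ IsDivisorGenerated (X.powSucc N) :=
  exists_not_isDivisorGenerated_powSucc_of_shared_imaginary_quadratic hcm hB hB' hB0 hB'0 hBX hB'X hBB' (k := F) hF2
    (e.toRingHom.comp F.val.toRingHom) g

end SharedQuadratic

/-! ## §3 Obstructions (¬ii′) and (¬iii′): four threefolds with one field, three surfaces with one closure -/

section Counting

/-- **Locating factors in a regrouping.**  Given Milne's regrouping data `(A'_c)` (simple, pairwise non-isogenous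
representatives with `X ≼ ⨁ᵢ A'_{cls i}`) and finitely many pairwise non-isogenous SIMPLE isogeny factors `T_a` of `X` of
positive dimension, there is an INJECTIVE choice of representatives `c a` with `T_a ∼ A'_{c a}` (uniqueness of the simple
isogeny factors). [cite: MumfordAV1970, §19 Thm. 1, Cor. 1–2 (pp. 173–174)] -/
theorem exists_injective_isIsogenous_of_factors {C : Type} {A' : C → AbelianVariety ℂ} {m : ℕ} {cls : Fin (m + 1) → C}
    (hs : ∀ c, (A' c).IsSimple) (hXP : AVDominatedBy X (⨁ fun i => A' (cls i))) {n : ℕ} {T : Fin n → AbelianVariety ℂ}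
    (hT : ∀ a, (T a).IsSimple) (hT0 : ∀ a, 0 < (T a).dim) (hTX : ∀ a, AVDominatedBy (T a) X)
    (hTn : ∀ a b, a ≠ b → ¬ IsIsogenous (T a) (T b)) :
    ∃ c : Fin n → C, Function.Injective c ∧ ∀ a, IsIsogenous (T a) (A' (c a)) := by
  have key : ∀ a, ∃ i, IsIsogenous (T a) (A' (cls i)) := fun a =>
    exists_isIsogenous_of_isSimple_of_avDominatedBy_biproduct (F := fun i => A' (cls i)) (fun i => hs (cls i)) (hT a)
      (hT0 a) ((hTX a).trans hXP)
  choose i hi using key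
  refine ⟨fun a => cls (i a), fun a b hab => ?_, hi⟩
  by_contra hne
  have hb : IsIsogenous (T b) (A' (cls (i a))) := by
    have h := hi b
    simp only at hab
    rwa [← hab] at h
  exact hTn a b hne ((hi a).trans hb.symm')

/-- The CM field of a representative is ring-isomorphic to the endomorphism algebra of any simple variety isogenous to it
(`K ≅ End⁰(A') ≅ End⁰(T)`: Shimura §5.1 and isogeny invariance of `End⁰`). [cite: Shimura1998, §5.1 Props. 3–6]
[cite: MumfordAV1970, §19 Cor. 2] -/
theorem nonempty_ringEquiv_endAlgebra_of_isIsogenous {K : Type} [Field K] [NumberField K] [IsCMField K] {Φ : CMType K}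
    {A T : AbelianVariety ℂ} {ι : 𝓞 K →+* End A} {θ : K →+* Module.End ℂ (complexBetti A.X 1)}
    (hA : IsCMTypeRealisation Φ A ι θ) (hs : A.IsSimple) (hT : IsIsogenous T A) : Nonempty (K ≃+* T.endAlgebra) := by
  obtain ⟨e⟩ := nonempty_ringEquiv_endAlgebra_of_isSimple hA hs
  obtain ⟨u⟩ := hT.nonempty_endAlgebra_algEquiv
  exact ⟨e.trans u.toRingEquiv.symm⟩

open scoped Classical in
/-- **(¬ii′) ⟹ an exotic Hodge class on some power — EVERY dimension.**  Let `X` be a complex abelian variety of CM type and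
`T₀, …, T₃` four pairwise NON-ISOGENOUS SIMPLE abelian THREEFOLDS among the isogeny factors of `X` whose endomorphism
algebras are pairwise isomorphic (one sextic CM field, four isogeny classes).  Then some power `X^{N+1}` is NOT
divisor-generated.  (The four representatives `A'_{c a} ∼ T_a` form a sub-family of threefolds with one field up to
isomorphism, violating condition (ii) «at most three» of the census `isNondegenerateFamily_simpleFamily_dim_le_three_iff`;
sub-families of nondegenerate families are nondegenerate; Hazama–Murty; products of representatives are isogeny factors of
powers.) [cite: MoonenZarhin1999LowDim, §3 (3.1)] [cite: Gordon1999HodgeAVSurvey, 7.5–7.7 and 9.4] -/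
theorem exists_not_isDivisorGenerated_powSucc_of_four_threefold_factors (hcm : IsOfCMType X)
    {T : Fin 4 → AbelianVariety ℂ} (hT : ∀ a, (T a).IsSimple) (hT3 : ∀ a, (T a).dim = 3)
    (hTX : ∀ a, AVDominatedBy (T a) X) (hTn : ∀ a b, a ≠ b → ¬ IsIsogenous (T a) (T b))
    (hTe : ∀ a b, Nonempty ((T a).endAlgebra ≃+* (T b).endAlgebra)) :
    ∃ N : ℕ, ¬ IsDivisorGenerated (X.powSucc N) := by
  classical
  have hX0 : 0 < X.dim := dim_pos_of_avDominatedBy (by rw [hT3 0]; norm_num) (hTX 0)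
  obtain ⟨C, _, K', _, _, _, Φ', A', ι', θ', m, cls, f, hA, hs, hniso, hcls, hf⟩ :=
    exists_isIsogeny_biproduct_of_isSimple_of_isOfCMType (X := X) hX0 hcm
  haveI : Nonempty C := ⟨cls 0⟩
  have hXP : AVDominatedBy X (⨁ fun i => A' (cls i)) := AVDominatedBy.of_isIsogeny_hom hf (AVDominatedBy.refl _)
  obtain ⟨c, hc, hTc⟩ := exists_injective_isIsogenous_of_factors (X := X) hs hXP hT
    (fun a => by rw [hT3 a]; norm_num) hTX hTn
  -- the sub-family of the four representatives
  have h3c : ∀ a, (A' (c a)).dim = 3 := fun a => by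
    obtain ⟨g, hg⟩ := hTc a; rw [← dim_eq_of_isIsogeny hg, hT3 a]
  have h6c : ∀ a, finrank ℚ (K' (c a)) = 6 := fun a => by
    rw [finrank_eq_two_mul_dim_of_isCMTypeRealisation (hA (c a)), h3c a]
  have heK : ∀ a b, Nonempty (K' (c a) ≃+* K' (c b)) := fun a b => by
    obtain ⟨ea⟩ := nonempty_ringEquiv_endAlgebra_of_isIsogenous (hA (c a)) (hs (c a)) (hTc a)
    obtain ⟨eb⟩ := nonempty_ringEquiv_endAlgebra_of_isIsogenous (hA (c b)) (hs (c b)) (hTc b)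
    obtain ⟨u⟩ := hTe a b
    exact ⟨(ea.trans u).trans eb.symm⟩
  have hdeg : ¬ CMAlgebra.IsNondegenerateFamily Φ' := by
    intro hnd
    have hsub := isNondegenerateFamily_comp_of_injective hnd c hc
    have hii := ((isNondegenerateFamily_simpleFamily_dim_le_three_iff (K := fun a => K' (c a))
      (Φ := fun a => Φ' (c a)) (A := fun a => A' (c a)) (ι := fun a => ι' (c a)) (θ := fun a => θ' (c a))
      (fun a => hA (c a)) (fun a => hs (c a)) (fun a b hab => hniso _ _ (hc.ne hab))
      (fun a => (h3c a).le)).1 hsub).2.1 0 (h6c 0)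
    have hfilter : (Finset.univ.filter fun b : Fin 4 => Nonempty (K' (c b) ≃+* K' (c 0))) = Finset.univ :=
      Finset.filter_true_of_mem fun b _ => heK b 0
    rw [hfilter, Finset.card_univ, Fintype.card_fin] at hii
    omega
  obtain ⟨N, π, mm, cc, hcQ, hcH, hcD⟩ := CMAlgebra.exists_exceptional_prod_of_not_isNondegenerateFamily
    (CMAlgebra.isSeparatingFamily_of_isSimple_of_pairwise_not_isIsogenous hA hs hniso) hdeg hA
  obtain ⟨M, hM⟩ := exists_avDominatedBy_biproduct_slots_powSucc hcls ⟨f, hf⟩ π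
  exact ⟨M, fun hD => hcD (isDivisorGenerated_of_avDominatedBy hM hD mm cc hcQ hcH)⟩

open scoped Classical in
/-- **(¬iii′) ⟹ an exotic Hodge class on some power — EVERY dimension.**  Let `X` be a complex abelian variety of CM type and
`S₀, S₁, S₂` three pairwise NON-ISOGENOUS SIMPLE abelian SURFACES among the isogeny factors of `X` whose endomorphism fields
have the SAME intrinsic Galois closure `⨆_{f : End⁰(S_a) →+* ℂ} ℚ(range f) ≤ ℂ` (three of the four isogeny classes of simple
CM surfaces inside one dihedral octic closure: seat p2's dihedral triple).  Then some power `X^{N+1}` is NOT divisor-generated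
(condition (iii) «at most two» of the census on the sub-family of the three representatives).
[cite: MoonenZarhin1999LowDim, §3 (3.9)] [cite: Gordon1999HodgeAVSurvey, 7.5–7.7] [cite: Shimura1998, §8.4] -/
theorem exists_not_isDivisorGenerated_powSucc_of_three_surface_factors (hcm : IsOfCMType X)
    {S : Fin 3 → AbelianVariety ℂ} (hS : ∀ a, (S a).IsSimple) (hS2 : ∀ a, (S a).dim = 2)
    (hSX : ∀ a, AVDominatedBy (S a) X) (hSn : ∀ a b, a ≠ b → ¬ IsIsogenous (S a) (S b))
    (hSe : ∀ a b, (⨆ f : (S a).endAlgebra →+* ℂ, IntermediateField.adjoin ℚ (Set.range f)) =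
      ⨆ f : (S b).endAlgebra →+* ℂ, IntermediateField.adjoin ℚ (Set.range f)) :
    ∃ N : ℕ, ¬ IsDivisorGenerated (X.powSucc N) := by
  classical
  have hX0 : 0 < X.dim := dim_pos_of_avDominatedBy (by rw [hS2 0]; norm_num) (hSX 0)
  obtain ⟨C, _, K', _, _, _, Φ', A', ι', θ', m, cls, f, hA, hs, hniso, hcls, hf⟩ :=
    exists_isIsogeny_biproduct_of_isSimple_of_isOfCMType (X := X) hX0 hcm
  haveI : Nonempty C := ⟨cls 0⟩
  have hXP : AVDominatedBy X (⨁ fun i => A' (cls i)) := AVDominatedBy.of_isIsogeny_hom hf (AVDominatedBy.refl _)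
  obtain ⟨c, hc, hSc⟩ := exists_injective_isIsogenous_of_factors (X := X) hs hXP hS
    (fun a => by rw [hS2 a]; norm_num) hSX hSn
  have h2c : ∀ a, (A' (c a)).dim = 2 := fun a => by
    obtain ⟨g, hg⟩ := hSc a; rw [← dim_eq_of_isIsogeny hg, hS2 a]
  have h4c : ∀ a, finrank ℚ (K' (c a)) = 4 := fun a => by
    rw [finrank_eq_two_mul_dim_of_isCMTypeRealisation (hA (c a)), h2c a]
  have hLK : ∀ a b, normalClosure ℚ (K' (c a)) ℂ = normalClosure ℚ (K' (c b)) ℂ := fun a b => by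
    obtain ⟨ea⟩ := nonempty_ringEquiv_endAlgebra_of_isIsogenous (hA (c a)) (hs (c a)) (hSc a)
    obtain ⟨eb⟩ := nonempty_ringEquiv_endAlgebra_of_isIsogenous (hA (c b)) (hs (c b)) (hSc b)
    exact normalClosure_eq_of_iSup_adjoin_range_eq ea eb (hSe a b)
  have hdeg : ¬ CMAlgebra.IsNondegenerateFamily Φ' := by
    intro hnd
    have hsub := isNondegenerateFamily_comp_of_injective hnd c hc
    have hiii := ((isNondegenerateFamily_simpleFamily_dim_le_three_iff (K := fun a => K' (c a))
      (Φ := fun a => Φ' (c a)) (A := fun a => A' (c a)) (ι := fun a => ι' (c a)) (θ := fun a => θ' (c a))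
      (fun a => hA (c a)) (fun a => hs (c a)) (fun a b hab => hniso _ _ (hc.ne hab))
      (fun a => by rw [h2c a]; norm_num)).1 hsub).2.2 0 (h4c 0)
    have hfilter : (Finset.univ.filter fun b : Fin 3 =>
        normalClosure ℚ (K' (c b)) ℂ = normalClosure ℚ (K' (c 0)) ℂ) = Finset.univ :=
      Finset.filter_true_of_mem fun b _ => hLK b 0
    rw [hfilter, Finset.card_univ, Fintype.card_fin] at hiii
    omega
  obtain ⟨N, π, mm, cc, hcQ, hcH, hcD⟩ := CMAlgebra.exists_exceptional_prod_of_not_isNondegenerateFamily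
    (CMAlgebra.isSeparatingFamily_of_isSimple_of_pairwise_not_isIsogenous hA hs hniso) hdeg hA
  obtain ⟨M, hM⟩ := exists_avDominatedBy_biproduct_slots_powSucc hcls ⟨f, hf⟩ π
  exact ⟨M, fun hD => hcD (isDivisorGenerated_of_avDominatedBy hM hD mm cc hcQ hcH)⟩

end Counting

end Summit.HodgeConjecture.CorCM

end
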